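import Summits.QuantumFields.BalabanUV.InfraRed.StrongCouplingTwelveSeventhsBrackets
import HarnessLib

/-!
# The ball-flux certificate beyond tilt `12/7`, part 1: series brackets on `0 ≤ κ ≤ 2`
(pub-ymgap track (a), A4-K kernel port) — strong-coupling bookkeeping for the slab area-law door; no mass-gap claim

HONEST FRAMING. This file extends the tree's Taylor-bracket machinery for the eleven one-dimensional integrals of the
ball-flux certificate of `QuarterCovariance` (pub-balaban, `StrongCouplingTwelveSeventhsBrackets`, valid on
`0 ≤ κ ≤ 12/7`) to the tilt range `0 ≤ κ ≤ 2`, i.e. to one-link laws `ν_B` of `SU(2)` with `‖B‖_op ≤ 1/2`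
(Wilson `β_W ≤ 1/3` on the slab door of the cell, `6 β_W ≤ 2`).  It is elementary real analysis about explicit
power series; it makes no statement about lattice measures, confinement or the mass gap.

WHAT THIS FILE PROVES.
* `exp_le_of_le_two`: `e^κ ≤ 739/100` for `κ ≤ 2` (from Mathlib's `Real.exp_one_lt_d9`, squared).
* `sphere_bracket2` / `ball_bracket2` / `sphere_eval2` / `ball_eval2` / `ball_nonneg2`: two-sided Taylor brackets of
  `∫ x₀^k e^{κ x₀} dσ` and `∫₀¹ r^a ∫ x₀^k e^{κ r x₀} dσ dr` on `0 ≤ κ ≤ K ≤ 2`, with the tail constant `739/100`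
  (the tree's `…127` lemmas with `12/7 ↦ 2`, `28/5 ↦ 739/100`, and the UPPER partial sum evaluated at a piece top
  `K` rather than at the range top).
* `moments_two`: the Haar moments `m₀ … m₁₇` of `x₀ = Re q` on `SU(2) ≅ S³` (`1, 0, 1/4, 0, 1/8, …, 715/32768, 0`),
  from the tree's `moment_table`, `moment_twelve`, `moment_thirteen`, `integral_re_pow_add_two`,
  `integral_re_pow_odd`.
* `Z_bracket2`, `Zp_bracket2`, `zB_bracket2`: the degree-`13` symbolic brackets of `Z`, `Z'`, `z_B` on `0 ≤ κ ≤ 2`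
  (tail `(739/100) κ¹⁴/14! = 739 κ¹⁴ / 8717829120000`).
Part 2 (`BallCertificateTwo`) uses these on the pieces `[12/7, 13/7]`, `[13/7, 2]`.

Certificate data (engine-2, cell pub-ymgap): `run/shared/lean/pub/pub-ymgap/pub-ymgap-engine-2/A4K-CERT.md`,
`a4k/gen_pieces_two.py`.  No number of any ledger moves in this file.
-/

noncomputable section

open MeasureTheory Filter Finset Real intervalIntegral
open scoped NNReal Quaternion Matrix BigOperators Topology Nat
open Matrix Complex
open Literature.MathematicalPhysics.QuantumLattice (su2Quat)
open Literature.MathematicalPhysics.QuantumFieldTheory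
open Literature.MathematicalPhysics.QuantumFieldTheory.Balaban1983to89.StrongCouplingVarianceWindow
  (integral_re_pow_odd)
open Summit.QuantumFields.BalabanUV.InfraRed.StrongCouplingHaarMoments (hasSum_integral_pow_mul_exp
  integral_re_pow_add_two)
open Summit.QuantumFields.BalabanUV.InfraRed.StrongCouplingBallSeries
open Summit.QuantumFields.BalabanUV.InfraRed.StrongCouplingBallCertificate (moment_table)
open Summit.QuantumFields.BalabanUV.InfraRed.StrongCouplingEightFifthsBrackets (partial_mono moment_twelve
  moment_thirteen)

namespace Summit.Ventures.YMGap.BallBracketsTwo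

/-! ## 1. Series brackets on `0 ≤ κ ≤ 2` -/

/-- **`e^κ ≤ 739/100` on the range `κ ≤ 2`** (`e < 2.7182818286`, squared). [folklore] -/
theorem exp_le_of_le_two {κ : ℝ} (hκ : κ ≤ 2) : Real.exp κ ≤ 739 / 100 := by
  have h1 := Real.exp_one_lt_d9
  have h0 : 0 ≤ Real.exp 1 := (Real.exp_pos 1).le
  have e : Real.exp 2 = Real.exp 1 * Real.exp 1 := by rw [← Real.exp_add]; norm_num
  have h2 : Real.exp 2 ≤ 739 / 100 := by rw [e]; nlinarith
  exact (Real.exp_le_exp.2 hκ).trans h2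

/-- The upper bracket as a function of `κ ∈ [0, 2]`: `S ≤ Σ_{n<N} x_n κ^n + (739/100) κ^N / N!`. [folklore] -/
theorem le_partial_add_of_hasSum2 {x : ℕ → ℝ} {κ S : ℝ} (hκ : 0 ≤ κ) (hκ' : κ ≤ 2)
    (hx : ∀ n, x n ≤ 1 / n !) (h : HasSum (fun n => x n * κ ^ n) S) (N : ℕ) :
    S ≤ ∑ n ∈ range N, x n * κ ^ n + 739 / 100 * κ ^ N / N ! := by
  have h1 := le_partial_add_of_hasSum hκ hx h N
  have h3 : κ ^ N * Real.exp κ / N ! ≤ 739 / 100 * κ ^ N / N ! := by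
    have hN : (0 : ℝ) < N ! := by positivity
    rw [div_le_div_iff₀ hN hN]
    refine mul_le_mul_of_nonneg_right ?_ hN.le
    rw [mul_comm]
    exact mul_le_mul_of_nonneg_right (exp_le_of_le_two hκ') (pow_nonneg hκ N)
  linarith

/-- Monotonicity of the evaluated bracket: `Σ_{n<N} x_n κ^n + (739/100)κ^N/N! ≤ Σ_{n<N} x_n K^n + (739/100)K^N/N!`
for `0 ≤ κ ≤ K`, `x_n ≥ 0`. [folklore] -/
theorem partial_add_mono2 {x : ℕ → ℝ} {κ K : ℝ} (hκ : 0 ≤ κ) (hκK : κ ≤ K) (hx0 : ∀ n, 0 ≤ x n) (N : ℕ) :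
    ∑ n ∈ range N, x n * κ ^ n + 739 / 100 * κ ^ N / N ! ≤
      ∑ n ∈ range N, x n * K ^ n + 739 / 100 * K ^ N / N ! := by
  have h2 : ∑ n ∈ range N, x n * κ ^ n ≤ ∑ n ∈ range N, x n * K ^ n :=
    sum_le_sum fun n _ => mul_le_mul_of_nonneg_left (pow_le_pow_left₀ hκ hκK n) (hx0 n)
  have h3 : 739 / 100 * κ ^ N / N ! ≤ 739 / 100 * K ^ N / N ! :=
    div_le_div_of_nonneg_right (mul_le_mul_of_nonneg_left (pow_le_pow_left₀ hκ hκK N) (by norm_num))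
      (by positivity)
  linarith

/-- **Two-sided bracket of an exponential (sphere) moment** on `0 ≤ κ ≤ 2`:
`Σ_{n<N} κ^n/n! m_{k+n} ≤ ∫ x₀^k e^{κ x₀} dσ ≤ (same sum) + (739/100) κ^N/N!`. [folklore] -/
theorem sphere_bracket2 (k : ℕ) {κ : ℝ} (hκ : 0 ≤ κ) (hκ' : κ ≤ 2) (N : ℕ) :
    ∑ n ∈ range N, κ ^ n / n ! * ∫ g : Matrix.specialUnitaryGroup (Fin 2) ℂ, (su2Quat g).re ^ (k + n) ∂(haarProbability (Matrix.specialUnitaryGroup (Fin 2) ℂ))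
      ≤ ∫ g : Matrix.specialUnitaryGroup (Fin 2) ℂ, (su2Quat g).re ^ k * Real.exp (κ * (su2Quat g).re) ∂(haarProbability (Matrix.specialUnitaryGroup (Fin 2) ℂ)) ∧
    ∫ g : Matrix.specialUnitaryGroup (Fin 2) ℂ, (su2Quat g).re ^ k * Real.exp (κ * (su2Quat g).re) ∂(haarProbability (Matrix.specialUnitaryGroup (Fin 2) ℂ))
      ≤ ∑ n ∈ range N, κ ^ n / n ! * ∫ g : Matrix.specialUnitaryGroup (Fin 2) ℂ, (su2Quat g).re ^ (k + n) ∂(haarProbability (Matrix.specialUnitaryGroup (Fin 2) ℂ)) + 739 / 100 * κ ^ N / N ! := by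
  have h := hasSum_integral_pow_mul_exp k κ
  have h' : HasSum (fun n : ℕ => (1 / (n ! * 1) * ∫ g : Matrix.specialUnitaryGroup (Fin 2) ℂ, (su2Quat g).re ^ (k + n) ∂(haarProbability (Matrix.specialUnitaryGroup (Fin 2) ℂ))) * κ ^ n)
      (∫ g : Matrix.specialUnitaryGroup (Fin 2) ℂ, (su2Quat g).re ^ k * Real.exp (κ * (su2Quat g).re) ∂(haarProbability (Matrix.specialUnitaryGroup (Fin 2) ℂ))) := by
    convert h using 1; funext n; ring
  have hlo := partial_le_of_hasSum hκ (fun n => (coeff_mem k n le_rfl).1) h' N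
  have hhi := le_partial_add_of_hasSum2 hκ hκ' (fun n => (coeff_mem k n le_rfl).2) h' N
  have e : ∑ n ∈ range N, (1 / (n ! * 1) * ∫ g : Matrix.specialUnitaryGroup (Fin 2) ℂ, (su2Quat g).re ^ (k + n) ∂(haarProbability (Matrix.specialUnitaryGroup (Fin 2) ℂ))) * κ ^ n =
      ∑ n ∈ range N, κ ^ n / n ! * ∫ g : Matrix.specialUnitaryGroup (Fin 2) ℂ, (su2Quat g).re ^ (k + n) ∂(haarProbability (Matrix.specialUnitaryGroup (Fin 2) ℂ)) := sum_congr rfl fun n _ => by ring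
  rw [e] at hlo hhi
  exact ⟨hlo, hhi⟩

/-- **Evaluated sphere bracket on a piece**: for `0 ≤ t ≤ κ ≤ K ≤ 2`,
`Σ_{n<N} t^n/n! m_{k+n} ≤ ∫ x₀^k e^{κ x₀} dσ ≤ Σ_{n<N} K^n/n! m_{k+n} + (739/100) K^N/N!`. [folklore] -/
theorem sphere_eval2 (k : ℕ) {t κ K : ℝ} (ht : 0 ≤ t) (htκ : t ≤ κ) (hκK : κ ≤ K) (hK : K ≤ 2) (N : ℕ) :
    ∑ n ∈ range N, t ^ n / n ! * ∫ g : Matrix.specialUnitaryGroup (Fin 2) ℂ, (su2Quat g).re ^ (k + n) ∂(haarProbability (Matrix.specialUnitaryGroup (Fin 2) ℂ))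
      ≤ ∫ g : Matrix.specialUnitaryGroup (Fin 2) ℂ, (su2Quat g).re ^ k * Real.exp (κ * (su2Quat g).re) ∂(haarProbability (Matrix.specialUnitaryGroup (Fin 2) ℂ)) ∧
    ∫ g : Matrix.specialUnitaryGroup (Fin 2) ℂ, (su2Quat g).re ^ k * Real.exp (κ * (su2Quat g).re) ∂(haarProbability (Matrix.specialUnitaryGroup (Fin 2) ℂ))
      ≤ ∑ n ∈ range N, K ^ n / n ! * ∫ g : Matrix.specialUnitaryGroup (Fin 2) ℂ, (su2Quat g).re ^ (k + n) ∂(haarProbability (Matrix.specialUnitaryGroup (Fin 2) ℂ)) + 739 / 100 * K ^ N / N ! := by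
  have hκ : 0 ≤ κ := ht.trans htκ
  obtain ⟨hlo, hhi⟩ := sphere_bracket2 k hκ (hκK.trans hK) N
  have hx0 : ∀ n : ℕ, 0 ≤ 1 / (n ! * 1) * ∫ g : Matrix.specialUnitaryGroup (Fin 2) ℂ, (su2Quat g).re ^ (k + n) ∂(haarProbability (Matrix.specialUnitaryGroup (Fin 2) ℂ)) :=
    fun n => (coeff_mem k n le_rfl).1
  have h1 := partial_mono ht htκ hx0 N
  have h2 := partial_add_mono2 hκ hκK hx0 N
  have e : ∀ s : ℝ, ∑ n ∈ range N, (1 / (n ! * 1) * ∫ g : Matrix.specialUnitaryGroup (Fin 2) ℂ, (su2Quat g).re ^ (k + n) ∂(haarProbability (Matrix.specialUnitaryGroup (Fin 2) ℂ))) * s ^ n =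
      ∑ n ∈ range N, s ^ n / n ! * ∫ g : Matrix.specialUnitaryGroup (Fin 2) ℂ, (su2Quat g).re ^ (k + n) ∂(haarProbability (Matrix.specialUnitaryGroup (Fin 2) ℂ)) :=
    fun s => sum_congr rfl fun n _ => by ring
  rw [e, e] at h1 h2
  exact ⟨h1.trans hlo, hhi.trans h2⟩

/-- **Two-sided bracket of a ball moment** on `0 ≤ κ ≤ 2`:
`Σ_{n<N} κ^n/(n!(n+a+1)) m_{k+n} ≤ ∫₀¹ r^a ∫ x₀^k e^{κ r x₀} dσ dr ≤ (same sum) + (739/100) κ^N/N!`. [folklore] -/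
theorem ball_bracket2 (k a : ℕ) {κ : ℝ} (hκ : 0 ≤ κ) (hκ' : κ ≤ 2) (N : ℕ) :
    ∑ n ∈ range N, κ ^ n / (n ! * (n + a + 1)) * ∫ g : Matrix.specialUnitaryGroup (Fin 2) ℂ, (su2Quat g).re ^ (k + n) ∂(haarProbability (Matrix.specialUnitaryGroup (Fin 2) ℂ))
      ≤ ∫ r in (0:ℝ)..1, r ^ a * ∫ g : Matrix.specialUnitaryGroup (Fin 2) ℂ, (su2Quat g).re ^ k * Real.exp (κ * r * (su2Quat g).re) ∂(haarProbability (Matrix.specialUnitaryGroup (Fin 2) ℂ)) ∧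
    ∫ r in (0:ℝ)..1, r ^ a * ∫ g : Matrix.specialUnitaryGroup (Fin 2) ℂ, (su2Quat g).re ^ k * Real.exp (κ * r * (su2Quat g).re) ∂(haarProbability (Matrix.specialUnitaryGroup (Fin 2) ℂ))
      ≤ ∑ n ∈ range N, κ ^ n / (n ! * (n + a + 1)) * ∫ g : Matrix.specialUnitaryGroup (Fin 2) ℂ, (su2Quat g).re ^ (k + n) ∂(haarProbability (Matrix.specialUnitaryGroup (Fin 2) ℂ))
        + 739 / 100 * κ ^ N / N ! := by
  have h := hasSum_ball k a κ
  have h' : HasSum (fun n : ℕ => (1 / (n ! * (n + a + 1)) * ∫ g : Matrix.specialUnitaryGroup (Fin 2) ℂ, (su2Quat g).re ^ (k + n) ∂(haarProbability (Matrix.specialUnitaryGroup (Fin 2) ℂ))) * κ ^ n)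
      (∫ r in (0:ℝ)..1, r ^ a * ∫ g : Matrix.specialUnitaryGroup (Fin 2) ℂ, (su2Quat g).re ^ k * Real.exp (κ * r * (su2Quat g).re) ∂(haarProbability (Matrix.specialUnitaryGroup (Fin 2) ℂ))) := by
    convert h using 1; funext n; ring
  have hw : ∀ n : ℕ, (1 : ℝ) ≤ n + a + 1 := fun n => by
    linarith [(Nat.cast_nonneg n : (0:ℝ) ≤ n), (Nat.cast_nonneg a : (0:ℝ) ≤ a)]
  have hlo := partial_le_of_hasSum hκ (fun n => (coeff_mem k n (hw n)).1) h' N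
  have hhi := le_partial_add_of_hasSum2 hκ hκ' (fun n => (coeff_mem k n (hw n)).2) h' N
  have e : ∑ n ∈ range N, (1 / (n ! * (n + a + 1)) * ∫ g : Matrix.specialUnitaryGroup (Fin 2) ℂ, (su2Quat g).re ^ (k + n) ∂(haarProbability (Matrix.specialUnitaryGroup (Fin 2) ℂ))) * κ ^ n =
      ∑ n ∈ range N, κ ^ n / (n ! * (n + a + 1)) * ∫ g : Matrix.specialUnitaryGroup (Fin 2) ℂ, (su2Quat g).re ^ (k + n) ∂(haarProbability (Matrix.specialUnitaryGroup (Fin 2) ℂ)) :=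
    sum_congr rfl fun n _ => by ring
  rw [e] at hlo hhi
  exact ⟨hlo, hhi⟩

/-- **Evaluated ball bracket on a piece**: for `0 ≤ t ≤ κ ≤ K ≤ 2`,
`Σ_{n<N} t^n/(n!(n+a+1)) m_{k+n} ≤ ∫₀¹ r^a ∫ x₀^k e^{κ r x₀} dσ dr ≤ Σ_{n<N} K^n/(n!(n+a+1)) m_{k+n} + (739/100)K^N/N!`.
[folklore] -/
theorem ball_eval2 (k a : ℕ) {t κ K : ℝ} (ht : 0 ≤ t) (htκ : t ≤ κ) (hκK : κ ≤ K) (hK : K ≤ 2) (N : ℕ) :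
    ∑ n ∈ range N, t ^ n / (n ! * (n + a + 1)) * ∫ g : Matrix.specialUnitaryGroup (Fin 2) ℂ, (su2Quat g).re ^ (k + n) ∂(haarProbability (Matrix.specialUnitaryGroup (Fin 2) ℂ))
      ≤ ∫ r in (0:ℝ)..1, r ^ a * ∫ g : Matrix.specialUnitaryGroup (Fin 2) ℂ, (su2Quat g).re ^ k * Real.exp (κ * r * (su2Quat g).re) ∂(haarProbability (Matrix.specialUnitaryGroup (Fin 2) ℂ)) ∧
    ∫ r in (0:ℝ)..1, r ^ a * ∫ g : Matrix.specialUnitaryGroup (Fin 2) ℂ, (su2Quat g).re ^ k * Real.exp (κ * r * (su2Quat g).re) ∂(haarProbability (Matrix.specialUnitaryGroup (Fin 2) ℂ))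
      ≤ ∑ n ∈ range N, K ^ n / (n ! * (n + a + 1)) * ∫ g : Matrix.specialUnitaryGroup (Fin 2) ℂ, (su2Quat g).re ^ (k + n) ∂(haarProbability (Matrix.specialUnitaryGroup (Fin 2) ℂ))
        + 739 / 100 * K ^ N / N ! := by
  have hκ : 0 ≤ κ := ht.trans htκ
  obtain ⟨hlo, hhi⟩ := ball_bracket2 k a hκ (hκK.trans hK) N
  have hw : ∀ n : ℕ, (1 : ℝ) ≤ n + a + 1 := fun n => by
    linarith [(Nat.cast_nonneg n : (0:ℝ) ≤ n), (Nat.cast_nonneg a : (0:ℝ) ≤ a)]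
  have hx0 : ∀ n : ℕ, 0 ≤ 1 / (n ! * (n + a + 1)) * ∫ g : Matrix.specialUnitaryGroup (Fin 2) ℂ, (su2Quat g).re ^ (k + n) ∂(haarProbability (Matrix.specialUnitaryGroup (Fin 2) ℂ)) :=
    fun n => (coeff_mem k n (hw n)).1
  have h1 := partial_mono ht htκ hx0 N
  have h2 := partial_add_mono2 hκ hκK hx0 N
  have e : ∀ s : ℝ, ∑ n ∈ range N, (1 / (n ! * (n + a + 1)) * ∫ g : Matrix.specialUnitaryGroup (Fin 2) ℂ, (su2Quat g).re ^ (k + n) ∂(haarProbability (Matrix.specialUnitaryGroup (Fin 2) ℂ))) * s ^ n =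
      ∑ n ∈ range N, s ^ n / (n ! * (n + a + 1)) * ∫ g : Matrix.specialUnitaryGroup (Fin 2) ℂ, (su2Quat g).re ^ (k + n) ∂(haarProbability (Matrix.specialUnitaryGroup (Fin 2) ℂ)) :=
    fun s => sum_congr rfl fun n _ => by ring
  rw [e, e] at h1 h2
  exact ⟨h1.trans hlo, hhi.trans h2⟩

/-- Every ball moment is non-negative on `0 ≤ κ ≤ 2` (empty partial sum). [folklore] -/
theorem ball_nonneg2 (k a : ℕ) {κ : ℝ} (hκ : 0 ≤ κ) (hκ' : κ ≤ 2) :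
    0 ≤ ∫ r in (0:ℝ)..1, r ^ a * ∫ g : Matrix.specialUnitaryGroup (Fin 2) ℂ, (su2Quat g).re ^ k * Real.exp (κ * r * (su2Quat g).re) ∂(haarProbability (Matrix.specialUnitaryGroup (Fin 2) ℂ)) := by
  simpa using (ball_bracket2 k a hκ hκ' 0).1

/-! ## 2. The moment table `m₀ … m₁₇` -/

/-- The Haar moments `∫ x₀ⁿ dσ`, `n = 0 … 17`, of `SU(2)`:
`1, 0, 1/4, 0, 1/8, 0, 5/64, 0, 7/128, 0, 21/512, 0, 33/1024, 0, 429/16384, 0, 715/32768, 0`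
(Catalan numbers `C_j/4^j`; odd moments vanish). [folklore] -/
theorem moments_two :
    (∫ g : Matrix.specialUnitaryGroup (Fin 2) ℂ, (su2Quat g).re ^ 0 ∂haarProbability (Matrix.specialUnitaryGroup (Fin 2) ℂ) = 1) ∧
    (∫ g : Matrix.specialUnitaryGroup (Fin 2) ℂ, (su2Quat g).re ^ 1 ∂haarProbability (Matrix.specialUnitaryGroup (Fin 2) ℂ) = 0) ∧
    (∫ g : Matrix.specialUnitaryGroup (Fin 2) ℂ, (su2Quat g).re ^ 2 ∂haarProbability (Matrix.specialUnitaryGroup (Fin 2) ℂ) = 1 / 4) ∧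
    (∫ g : Matrix.specialUnitaryGroup (Fin 2) ℂ, (su2Quat g).re ^ 3 ∂haarProbability (Matrix.specialUnitaryGroup (Fin 2) ℂ) = 0) ∧
    (∫ g : Matrix.specialUnitaryGroup (Fin 2) ℂ, (su2Quat g).re ^ 4 ∂haarProbability (Matrix.specialUnitaryGroup (Fin 2) ℂ) = 1 / 8) ∧
    (∫ g : Matrix.specialUnitaryGroup (Fin 2) ℂ, (su2Quat g).re ^ 5 ∂haarProbability (Matrix.specialUnitaryGroup (Fin 2) ℂ) = 0) ∧
    (∫ g : Matrix.specialUnitaryGroup (Fin 2) ℂ, (su2Quat g).re ^ 6 ∂haarProbability (Matrix.specialUnitaryGroup (Fin 2) ℂ) = 5 / 64) ∧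
    (∫ g : Matrix.specialUnitaryGroup (Fin 2) ℂ, (su2Quat g).re ^ 7 ∂haarProbability (Matrix.specialUnitaryGroup (Fin 2) ℂ) = 0) ∧
    (∫ g : Matrix.specialUnitaryGroup (Fin 2) ℂ, (su2Quat g).re ^ 8 ∂haarProbability (Matrix.specialUnitaryGroup (Fin 2) ℂ) = 7 / 128) ∧
    (∫ g : Matrix.specialUnitaryGroup (Fin 2) ℂ, (su2Quat g).re ^ 9 ∂haarProbability (Matrix.specialUnitaryGroup (Fin 2) ℂ) = 0) ∧
    (∫ g : Matrix.specialUnitaryGroup (Fin 2) ℂ, (su2Quat g).re ^ 10 ∂haarProbability (Matrix.specialUnitaryGroup (Fin 2) ℂ) = 21 / 512) ∧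
    (∫ g : Matrix.specialUnitaryGroup (Fin 2) ℂ, (su2Quat g).re ^ 11 ∂haarProbability (Matrix.specialUnitaryGroup (Fin 2) ℂ) = 0) ∧
    (∫ g : Matrix.specialUnitaryGroup (Fin 2) ℂ, (su2Quat g).re ^ 12 ∂haarProbability (Matrix.specialUnitaryGroup (Fin 2) ℂ) = 33 / 1024) ∧
    (∫ g : Matrix.specialUnitaryGroup (Fin 2) ℂ, (su2Quat g).re ^ 13 ∂haarProbability (Matrix.specialUnitaryGroup (Fin 2) ℂ) = 0) ∧
    (∫ g : Matrix.specialUnitaryGroup (Fin 2) ℂ, (su2Quat g).re ^ 14 ∂haarProbability (Matrix.specialUnitaryGroup (Fin 2) ℂ) = 429 / 16384) ∧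
    (∫ g : Matrix.specialUnitaryGroup (Fin 2) ℂ, (su2Quat g).re ^ 15 ∂haarProbability (Matrix.specialUnitaryGroup (Fin 2) ℂ) = 0) ∧
    (∫ g : Matrix.specialUnitaryGroup (Fin 2) ℂ, (su2Quat g).re ^ 16 ∂haarProbability (Matrix.specialUnitaryGroup (Fin 2) ℂ) = 715 / 32768) ∧
    (∫ g : Matrix.specialUnitaryGroup (Fin 2) ℂ, (su2Quat g).re ^ 17 ∂haarProbability (Matrix.specialUnitaryGroup (Fin 2) ℂ) = 0) := by
  obtain ⟨m0, m1, m2, m3, m4, m5, m6, m7, m8, m9, m10, m11⟩ := moment_table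
  have m14 : ∫ g : Matrix.specialUnitaryGroup (Fin 2) ℂ, (su2Quat g).re ^ 14 ∂haarProbability (Matrix.specialUnitaryGroup (Fin 2) ℂ) = 429 / 16384 := by
    have h := integral_re_pow_add_two 12
    norm_num at h
    rw [moment_twelve] at h
    rw [h]; norm_num
  have m16 : ∫ g : Matrix.specialUnitaryGroup (Fin 2) ℂ, (su2Quat g).re ^ 16 ∂haarProbability (Matrix.specialUnitaryGroup (Fin 2) ℂ) = 715 / 32768 := by
    have h := integral_re_pow_add_two 14
    norm_num at h
    rw [m14] at h
    rw [h]; norm_num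
  have m15 : ∫ g : Matrix.specialUnitaryGroup (Fin 2) ℂ, (su2Quat g).re ^ 15 ∂haarProbability (Matrix.specialUnitaryGroup (Fin 2) ℂ) = 0 := by
    simpa using integral_re_pow_odd 7
  have m17 : ∫ g : Matrix.specialUnitaryGroup (Fin 2) ℂ, (su2Quat g).re ^ 17 ∂haarProbability (Matrix.specialUnitaryGroup (Fin 2) ℂ) = 0 := by
    simpa using integral_re_pow_odd 8
  exact ⟨m0, m1, m2, m3, m4, m5, m6, m7, m8, m9, m10, m11, moment_twelve, moment_thirteen, m14, m15, m16, m17⟩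

/-! ## 3. Symbolic brackets on `0 ≤ κ ≤ 2` -/

/-- `Z` is bracketed by its degree-`12` Taylor polynomial, `0 ≤ κ ≤ 2`
(tail `(739/100)κ¹⁴/14! = 739 κ¹⁴ / 8717829120000`). [folklore] -/
theorem Z_bracket2 {κ : ℝ} (hκ : 0 ≤ κ) (hκ' : κ ≤ 2) :
    1 + κ ^ 2 / 8 + κ ^ 4 / 192 + κ ^ 6 / 9216 + κ ^ 8 / 737280 + κ ^ 10 / 88473600 + κ ^ 12 / 14863564800
      ≤ ∫ g : Matrix.specialUnitaryGroup (Fin 2) ℂ, Real.exp (κ * (su2Quat g).re) ∂(haarProbability (Matrix.specialUnitaryGroup (Fin 2) ℂ)) ∧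
    ∫ g : Matrix.specialUnitaryGroup (Fin 2) ℂ, Real.exp (κ * (su2Quat g).re) ∂(haarProbability (Matrix.specialUnitaryGroup (Fin 2) ℂ))
      ≤ 1 + κ ^ 2 / 8 + κ ^ 4 / 192 + κ ^ 6 / 9216 + κ ^ 8 / 737280 + κ ^ 10 / 88473600 + κ ^ 12 / 14863564800
        + 739 * κ ^ 14 / 8717829120000 := by
  have h := sphere_bracket2 0 hκ hκ' 14
  obtain ⟨m0, m1, m2, m3, m4, m5, m6, m7, m8, m9, m10, m11, m12, m13, -, -, -, -⟩ := moments_two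
  simp only [sum_range_succ, sum_range_zero, Nat.reduceAdd, m0, m1, m2, m3, m4, m5, m6, m7, m8, m9, m10, m11,
    m12, m13, Nat.factorial, Nat.succ_eq_add_one, Nat.reduceMul, Nat.cast_ofNat, Nat.cast_one] at h
  simp only [pow_zero, one_mul] at h
  norm_num at h
  constructor <;> linarith [h.1, h.2]

/-- `Z'` is bracketed by its degree-`13` Taylor polynomial, `0 ≤ κ ≤ 2`. [folklore] -/
theorem Zp_bracket2 {κ : ℝ} (hκ : 0 ≤ κ) (hκ' : κ ≤ 2) :
    κ / 4 + κ ^ 3 / 48 + κ ^ 5 / 1536 + κ ^ 7 / 92160 + κ ^ 9 / 8847360 + κ ^ 11 / 1238630400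
        + κ ^ 13 / 237817036800
      ≤ ∫ g : Matrix.specialUnitaryGroup (Fin 2) ℂ, (su2Quat g).re * Real.exp (κ * (su2Quat g).re) ∂(haarProbability (Matrix.specialUnitaryGroup (Fin 2) ℂ)) ∧
    ∫ g : Matrix.specialUnitaryGroup (Fin 2) ℂ, (su2Quat g).re * Real.exp (κ * (su2Quat g).re) ∂(haarProbability (Matrix.specialUnitaryGroup (Fin 2) ℂ))
      ≤ κ / 4 + κ ^ 3 / 48 + κ ^ 5 / 1536 + κ ^ 7 / 92160 + κ ^ 9 / 8847360 + κ ^ 11 / 1238630400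
        + κ ^ 13 / 237817036800 + 739 * κ ^ 14 / 8717829120000 := by
  have h := sphere_bracket2 1 hκ hκ' 14
  obtain ⟨-, m1, m2, m3, m4, m5, m6, m7, m8, m9, m10, m11, m12, m13, m14, -, -, -⟩ := moments_two
  simp only [sum_range_succ, sum_range_zero, Nat.reduceAdd, m1, m2, m3, m4, m5, m6, m7, m8, m9, m10, m11, m12,
    m13, m14, Nat.factorial, Nat.succ_eq_add_one, Nat.reduceMul, Nat.cast_ofNat, Nat.cast_one] at h
  simp only [pow_one] at h
  norm_num at h
  constructor <;> linarith [h.1, h.2]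

/-- `z_B` is bracketed by its degree-`12` polynomial, `0 ≤ κ ≤ 2`. [folklore] -/
theorem zB_bracket2 {κ : ℝ} (hκ : 0 ≤ κ) (hκ' : κ ≤ 2) :
    1 / 4 + κ ^ 2 / 48 + κ ^ 4 / 1536 + κ ^ 6 / 92160 + κ ^ 8 / 8847360 + κ ^ 10 / 1238630400
        + κ ^ 12 / 237817036800
      ≤ ∫ r in (0:ℝ)..1, r ^ 3 * ∫ g : Matrix.specialUnitaryGroup (Fin 2) ℂ, Real.exp (κ * r * (su2Quat g).re) ∂(haarProbability (Matrix.specialUnitaryGroup (Fin 2) ℂ)) ∧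
    ∫ r in (0:ℝ)..1, r ^ 3 * ∫ g : Matrix.specialUnitaryGroup (Fin 2) ℂ, Real.exp (κ * r * (su2Quat g).re) ∂(haarProbability (Matrix.specialUnitaryGroup (Fin 2) ℂ))
      ≤ 1 / 4 + κ ^ 2 / 48 + κ ^ 4 / 1536 + κ ^ 6 / 92160 + κ ^ 8 / 8847360 + κ ^ 10 / 1238630400
        + κ ^ 12 / 237817036800 + 739 * κ ^ 14 / 8717829120000 := by
  have h := ball_bracket2 0 3 hκ hκ' 14
  obtain ⟨m0, m1, m2, m3, m4, m5, m6, m7, m8, m9, m10, m11, m12, m13, -, -, -, -⟩ := moments_two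
  simp only [sum_range_succ, sum_range_zero, Nat.reduceAdd, m0, m1, m2, m3, m4, m5, m6, m7, m8, m9, m10, m11,
    m12, m13, Nat.factorial, Nat.succ_eq_add_one, Nat.reduceMul, Nat.cast_ofNat, Nat.cast_one] at h
  simp only [pow_zero, one_mul] at h
  norm_num at h
  constructor <;> linarith [h.1, h.2]

end Summit.Ventures.YMGap.BallBracketsTwo
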